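import Summits.Ventures.CertifiedArithmetic.LowPrec.SRLimitedBits
import Literature.ComputerArithmetic.ElararEtAl2025.LimitedPrecisionSR
import HarnessLib

/-!
# Limited-randomness SR, IV: the dictionary `SR_{p,r}` (El Arar–Fasi–Filip–Mikaitis) = `StochasticA`

HONEST FRAMING: certified error envelopes and provably optimal rounding/accumulation schemes for
low-precision formats under stated cost models; every table by two implementations; no hardware
or vendor claims.

The limited-precision stochastic rounding `SR_{p,r}` of [cite: ElararEtAl2025, §2.3 Def. 4]
(typed in `Literature.ComputerArithmetic.ElararEtAl2025`: round up with probability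
`q_r(x) = (tr_{p+r}(x) − ⌊x⌋)/ε`, the truncation written on the gap as
`truncGap F r x = ⌊x⌋ + ε⌊q(x)2^r⌋/2^r`) is, on the nonnegative part of the hull of `F`, EXACTLY the
IEEE P3109 `StochasticA` step with `N = r` random bits as modelled in files I–III
(`probAwayA r`, `pUpQ`, `stepQ`):
* `limProb_truncGap_eq_probAwayA`: `q_r(x) = probAwayA r (q(x))`;
* `limMean_truncGap_eq_stepQ`: `E(SR_{p,r}(x)) = stepQ F (probAwayA r) x id` (the one-step mean of
  the venture model), for every `x` in the hull with `0 ≤ ⌊x⌋`;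
* `stepQ_stochasticA_eq_truncGap`: hence the venture's StochasticA step mean is the truncation
  `tr_{p+r}(x)` itself (the source's "`E(SR_{p,r}(x)) = tr_{p+r}(x)`", §3), so the per-step bias of
  file II for rule A is the (nonpositive) truncation error, of size `< ε2^{-r}`.
Consequently every statement of files II–III about rule A (n-step bias bounds, non-minimaxity
`stochasticA_not_minimax`, stagnation threshold `ε/2^N`) is a statement about `SR_{p,r}`; the
half-bit rules B/C of P3109 are NOT of the form `SR_{p,r}` (they round the probability to nearest,
`|q − η| ≤ 2^{-(N+1)}`, and are minimax optimal, file III).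
On the negative side P3109 rounds the magnitude ("away from zero"), where `SR_{p,r}` applied to
the signed value and StochasticA differ by the reflection `η ↦ 1 − η` (`pUpQ`, else-branch); not
treated.
-/

namespace Summit.Ventures.CertifiedArithmetic.LowPrec.SR.LimitedBits

open Literature.ComputerArithmetic.ConnollyHighamMary2021
open Literature.ComputerArithmetic.ElararEtAl2025

variable {K : Type*} [Field K] [LinearOrder K] [IsStrictOrderedRing K] [FloorRing K]

omit [IsStrictOrderedRing K] in
/-- `q_r = probAwayA r ∘ q`: limited-precision SR with `r` random bits (gap truncation) has the
StochasticA away-probability, for `x ∉ F`. -/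
theorem limProb_truncGap_eq_probAwayA (F : Finset K) (r : ℕ) {x : K}
    (h : roundUp F x ≠ roundDown F x) :
    limProb F (truncGap F r) x = probAwayA r (probUp F x) := by
  rw [limProb_truncGap F r h]
  unfold probAwayA
  rfl

omit [IsStrictOrderedRing K] in
/-- **Dictionary.** On the nonnegative part of the hull (`x` between members of `F`, `0 ≤ ⌊x⌋`)
the mean of `SR_{p,r}(x)` equals the one-step mean of the venture's StochasticA model with `N = r`
bits. -/
theorem limMean_truncGap_eq_stepQ (F : Finset K) (r : ℕ) {x : K} (hx : InHull F x)
    (h0 : 0 ≤ dn F x) :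
    limMean F (truncGap F r) x = stepQ F (probAwayA r) x (fun t => t) := by
  have hc : clamp F x = x := clamp_eq_self hx
  unfold stepQ pUpQ
  rw [if_pos h0]
  unfold pUp up dn
  rw [hc]
  by_cases h : roundUp F x = roundDown F x
  · have hd : roundDown F x = x := eq_of_roundUp_eq_roundDown h
    unfold limMean limProb
    rw [h, hd]
    ring
  · unfold limMean
    rw [limProb_truncGap_eq_probAwayA F r h]

omit [IsStrictOrderedRing K] in
/-- Hence the StochasticA step mean is the gap truncation `tr_{p+r}(x) = ⌊x⌋ + ε⌊q(x)2^r⌋/2^r`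
("`E(SR_{p,r}(x)) = tr_{p+r}(x)`" of the source, §3), for `x ∉ F` in the nonnegative hull; its
bias `tr_{p+r}(x) − x` is `≤ 0` and `≥ −ε/2^r` (`Literature…limMean_truncGap_le`; file II). -/
theorem stepQ_stochasticA_eq_truncGap (F : Finset K) (r : ℕ) {x : K} (hx : InHull F x)
    (h0 : 0 ≤ dn F x) (h : roundUp F x ≠ roundDown F x) :
    stepQ F (probAwayA r) x (fun t => t) = truncGap F r x := by
  rw [← limMean_truncGap_eq_stepQ F r hx h0, limMean_eq F _ h]

/-- The dictionary in bias form: the venture's per-step StochasticA bias at such an `x` is the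
truncation error `tr_{p+r}(x) − x ∈ (−ε/2^r, 0]`. -/
theorem stepQ_stochasticA_bias (F : Finset K) (r : ℕ) {x : K} (hx : InHull F x)
    (h0 : 0 ≤ dn F x) (h : roundUp F x ≠ roundDown F x) :
    stepQ F (probAwayA r) x (fun t => t) - x = truncGap F r x - x ∧ truncGap F r x - x ≤ 0 ∧
      x - truncGap F r x ≤ (roundUp F x - roundDown F x) / 2 ^ r := by
  have hm := limMean_truncGap_le F r h
  rw [limMean_eq F _ h] at hm
  refine ⟨by rw [stepQ_stochasticA_eq_truncGap F r hx h0 h], by linarith [hm.1], hm.2⟩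

end Summit.Ventures.CertifiedArithmetic.LowPrec.SR.LimitedBits
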